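import Mathlib
import HarnessLib

/-!
# The fold (caustic) height of the transported prolate seed's sub-wall tail: `γ* = c + √(c² − χ)`

Helper file (`--supports stmt-RiemannHypothesis-0098`), pure elementary real algebra, no definitions.  Seat rh-explicit-weil-5
gen11 (file of record `HOME/rh-explicit-weil-5/WEIL5-ZSIDE.md` §2; blind ledger PREREG-ZSIDE-ADD1: 100/100 on 20 cells).

Context (documentation only; nothing below depends on it).  For a window `[-a, a]` put `μ = e^{2a}`, `c = 2πμ`.  Connes'
transport `𝓔S(x) = e^{x/2} Σ_{m ≤ μ} S(m e^{x-a})` of a prolate seed `S = ψ_n(·; c)` has, below the wall `x < -a`, a tail that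
samples the EXTERIOR prolate function at `t = e^{s'} > 1` (`s'` the depth below the wall); the exterior WKB wavenumber of
`(t²−1)ψ'' + 2tψ' + (c²t² − χ)ψ = 0` is `√((c²t² − χ)/(t² − 1))`, so the tail's instantaneous `x`-frequency at depth `s'` is
`ω(t) = t·√((c²t² − χ)/(t² − 1))`, i.e. `ω(t)² = t²(c²t² − χ)/(t² − 1)`.  By the explicit formula the window-truncated transport's
Mellin transform at a zero `ρ` of `ζ` equals minus that of the tail, so stationary phase puts NO spectral weight below
`γ* := min_t ω(t)` and an Airy fold at `γ*`.  This file proves the exact algebra that locates the fold: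

* `tailFreqSq_sub_sq_eq`            : `ω(t)² − (c + W)² = (c(t² − 1) − W)²/(t² − 1)` whenever `W² = c² − χ`, `t² ≠ 1`;
* `foldHeight_sq_le_tailFreqSq`     : hence `(c + √(c² − χ))² ≤ ω(t)²` for every `t > 1` (no stationary depth below `γ*`);
* `tailFreqSq_at_foldDepth`         : equality at the fold depth `t² = 1 + √(c² − χ)/c`;
* `foldHeight_le_two_mul`, `…_lt_…` : `c ≤ γ* ≤ 2c`, `γ* < 2c` when `χ > 0`, and `2c − χ/c ≤ γ*` — the «tangency height»
  `4πμ = 2c` of the rh-explicit STRUCTURE tables is the `χ/c² → 0` limit of `γ* = c + √(c² − χ)`.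

Standard axioms only; no `sorry`.
-/

set_option linter.dupNamespace false
set_option autoImplicit false

noncomputable section

namespace Summit.RiemannHypothesis.RiemannHypothesis.Theorems.WeilTransportFold

/-- THE ALGEBRAIC CORE.  For any real `W` with `W² = c² − χ` and `t² ≠ 1`:
`ω(t)² − (c + W)² = (c(t² − 1) − W)²/(t² − 1)` where `ω(t)² = t²(c²t² − χ)/(t² − 1)`. -/
theorem tailFreqSq_sub_sq_eq (c χ t W : ℝ) (hW : W ^ 2 = c ^ 2 - χ) (ht : t ^ 2 - 1 ≠ 0) :
    t ^ 2 * (c ^ 2 * t ^ 2 - χ) / (t ^ 2 - 1) - (c + W) ^ 2 = (c * (t ^ 2 - 1) - W) ^ 2 / (t ^ 2 - 1) := by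
  rw [eq_div_iff ht, sub_mul, div_mul_cancel₀ _ ht]
  linear_combination (-(t ^ 2)) * hW

/-- With `W = √(c² − χ)` (`χ ≤ c²`): `ω(t)² − γ*² = (c(t² − 1) − √(c² − χ))²/(t² − 1)`, `γ* = c + √(c² − χ)`. -/
theorem tailFreqSq_sub_foldHeight_sq (c χ t : ℝ) (hχ : χ ≤ c ^ 2) (ht : t ^ 2 - 1 ≠ 0) :
    t ^ 2 * (c ^ 2 * t ^ 2 - χ) / (t ^ 2 - 1) - (c + Real.sqrt (c ^ 2 - χ)) ^ 2
      = (c * (t ^ 2 - 1) - Real.sqrt (c ^ 2 - χ)) ^ 2 / (t ^ 2 - 1) := by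
  have hW : Real.sqrt (c ^ 2 - χ) ^ 2 = c ^ 2 - χ := Real.sq_sqrt (by linarith)
  exact tailFreqSq_sub_sq_eq c χ t _ hW ht

/-- NO STATIONARY DEPTH BELOW THE FOLD: for every depth (`t > 1`), `γ*² = (c + √(c² − χ))² ≤ ω(t)²`. -/
theorem foldHeight_sq_le_tailFreqSq (c χ t : ℝ) (hχ : χ ≤ c ^ 2) (ht : 1 < t) :
    (c + Real.sqrt (c ^ 2 - χ)) ^ 2 ≤ t ^ 2 * (c ^ 2 * t ^ 2 - χ) / (t ^ 2 - 1) := by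
  have ht2 : 0 < t ^ 2 - 1 := by nlinarith
  have h := tailFreqSq_sub_foldHeight_sq c χ t hχ ht2.ne'
  have hnn : 0 ≤ (c * (t ^ 2 - 1) - Real.sqrt (c ^ 2 - χ)) ^ 2 / (t ^ 2 - 1) :=
    div_nonneg (sq_nonneg _) ht2.le
  linarith

/-- THE FOLD IS ATTAINED: at the depth `t² = 1 + √(c² − χ)/c` (`c > 0`, `χ < c²`) one has `ω(t)² = γ*²`. -/
theorem tailFreqSq_at_foldDepth (c χ t : ℝ) (hc : 0 < c) (hχ : χ < c ^ 2)
    (ht : t ^ 2 = 1 + Real.sqrt (c ^ 2 - χ) / c) :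
    t ^ 2 * (c ^ 2 * t ^ 2 - χ) / (t ^ 2 - 1) = (c + Real.sqrt (c ^ 2 - χ)) ^ 2 := by
  have hpos : 0 < Real.sqrt (c ^ 2 - χ) := Real.sqrt_pos.mpr (by linarith)
  have ht1 : t ^ 2 - 1 = Real.sqrt (c ^ 2 - χ) / c := by rw [ht]; ring
  have hne : t ^ 2 - 1 ≠ 0 := by rw [ht1]; exact (div_pos hpos hc).ne'
  have h := tailFreqSq_sub_foldHeight_sq c χ t hχ.le hne
  have hzero : c * (t ^ 2 - 1) - Real.sqrt (c ^ 2 - χ) = 0 := by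
    rw [ht1]; field_simp; ring
  rw [hzero] at h
  simpa [zero_pow two_ne_zero] using (sub_eq_zero.mp (by simpa using h))

/-- The fold depth is a genuine depth: `1 < 1 + √(c² − χ)/c` for `c > 0`, `χ < c²`. -/
theorem one_lt_foldDepthSq (c χ : ℝ) (hc : 0 < c) (hχ : χ < c ^ 2) : 1 < 1 + Real.sqrt (c ^ 2 - χ) / c := by
  have hpos : 0 < Real.sqrt (c ^ 2 - χ) := Real.sqrt_pos.mpr (by linarith)
  have := div_pos hpos hc
  linarith

/-- `γ* = c + √(c² − χ) ≤ 2c` for `0 ≤ χ`, `c ≥ 0`: the fold never exceeds the tangency height `2c = 4πμ`. -/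
theorem foldHeight_le_two_mul (c χ : ℝ) (hc : 0 ≤ c) (hχ0 : 0 ≤ χ) : c + Real.sqrt (c ^ 2 - χ) ≤ 2 * c := by
  have h1 : Real.sqrt (c ^ 2 - χ) ≤ Real.sqrt (c ^ 2) := Real.sqrt_le_sqrt (by linarith)
  have h2 : Real.sqrt (c ^ 2) = c := Real.sqrt_sq hc
  linarith

/-- … strictly below it as soon as `χ > 0` (`c > 0`): `γ* < 2c`. -/
theorem foldHeight_lt_two_mul (c χ : ℝ) (hc : 0 < c) (hχ0 : 0 < χ) (hχ : χ ≤ c ^ 2) :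
    c + Real.sqrt (c ^ 2 - χ) < 2 * c := by
  have h1 : Real.sqrt (c ^ 2 - χ) < Real.sqrt (c ^ 2) :=
    Real.sqrt_lt_sqrt (by linarith) (by linarith)
  have h2 : Real.sqrt (c ^ 2) = c := Real.sqrt_sq hc.le
  linarith

/-- … and at least `c`: `c ≤ γ*`. -/
theorem le_foldHeight (c χ : ℝ) : c ≤ c + Real.sqrt (c ^ 2 - χ) := by
  have := Real.sqrt_nonneg (c ^ 2 - χ)
  linarith

/-- First-order lower bound `2c − χ/c ≤ γ*` (`c > 0`, `0 ≤ χ ≤ c²`): with `χ = χ_n(c) = O(c)` the fold sits `O(1)` below `2c`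
in absolute terms, i.e. at `2c(1 − O(1/c))` — the measured onsets `(1.948 … 1.995)·c` at `c = 126 … 933`. -/
theorem two_mul_sub_le_foldHeight (c χ : ℝ) (hc : 0 < c) (hχ0 : 0 ≤ χ) (hχ : χ ≤ c ^ 2) :
    2 * c - χ / c ≤ c + Real.sqrt (c ^ 2 - χ) := by
  -- `c − χ/c ≤ √(c² − χ)`: trivial if the left side is nonpositive, else compare squares.
  by_cases hneg : c - χ / c ≤ 0
  · have := Real.sqrt_nonneg (c ^ 2 - χ); linarith
  · rw [not_le] at hneg
    have hsq : (c - χ / c) ^ 2 ≤ c ^ 2 - χ := by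
      have hc0 : c ≠ 0 := hc.ne'
      have : (c - χ / c) ^ 2 = c ^ 2 - 2 * χ + χ ^ 2 / c ^ 2 := by field_simp; ring
      rw [this]
      have : χ ^ 2 / c ^ 2 ≤ χ := by
        rw [div_le_iff₀ (by positivity)]; nlinarith
      linarith
    have h := (Real.le_sqrt hneg.le (by linarith)).mpr hsq
    linarith

end Summit.RiemannHypothesis.RiemannHypothesis.Theorems.WeilTransportFold

end
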